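import Mathlib
import HarnessLib
import Literature.Probability.LatticeModels.CriticalAxisRatioRegularity
import Summits.CriticalPhenomena.Ising3DConformalLimit.Theses.ThresholdDilation

/-!
# `DyadicLawOfImplementer` — the glue `(R) → (V) → DyadicScalingLaw` of route ThresholdDilation
(item stmt-CriticalPhenomena-6325, support; PROOF)

Route `ThresholdDilation` on the critical nearest-neighbour Ising model on `ℤ³` realises the axis
two-point function `g(n) = ⟨σ₀σ_{n e₀}⟩⁺_{β_c(3)}` as matrix elements `⟪ψ, Tⁿ ψ⟫` of a positive
transfer contraction `T` ((R) = `TwoPlaneTransferRealisation`) and posits a bounded operator `V`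
implementing the dilation `x ↦ 2x` at low energy on the spin vector `ψ = ψ_{{0}}`
((V) = `ThresholdDilationImplementer`: near-isometry (Iso), intertwining `V Tᵐ ≈ T²ᵐ V` (Int) and
quasi-primarity `T²ᵐ V ψ ≈ 2^Δ T²ᵐ ψ` (QP), all with relative errors `→ 0`). This file proves the
route's support item `DyadicLawOfImplementer`: (R) and (V) together imply the dyadic scaling law
`g(2n)·4^Δ / g(n) → 1` (`DyadicScalingLaw`).

Proof (the route's sketch, no Tauberian theorem):
* `‖Tᵐ ψ‖² = ⟪ψ, T²ᵐ ψ⟫ = g(2m)` (`T` is self-adjoint, being positive; the matrix-element clause of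
  (R) at `A = B = {0}`, where `{0} ∆ {k e₀} = {0, k e₀}` and `σ_{{0, k e₀}} = σ₀ σ_{k e₀}`);
* with `u = Tᵐ ψ`, `w = T²ᵐ ψ`, `a = 2^Δ`, the three clauses give `|‖u‖ − a‖w‖| ≤ 2ε‖u‖ + ε‖w‖`
  eventually, hence `a‖w‖/‖u‖ → 1` and `g(4m)·4^Δ/g(2m) = (a‖w‖/‖u‖)² → 1` (even arguments);
* odd arguments follow from the in-tree AXIS RATIO REGULARITY `g(k+1)/g(k) → 1`
  (`criticalTwoPoint_axis_ratio_tendsto_one'`, log-convexity + Simon–Lieb):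
  `g(4m+2)·4^Δ/g(2m+1) = [g(4m)·4^Δ/g(2m)] · r(4m) · r(4m+1) / r(2m)` with `r(k) = g(k+1)/g(k)`.

The analytic lemmas (`tendsto_of_even_odd`, `tendsto_dyadic_of_even`,
`tendsto_ratio_of_eventual_bounds`) and the Hilbert-space identity `‖Tⁿx‖² = ⟪x, T²ⁿx⟫` are
stated abstractly; only `plusCorr_symmDiff_axis` and the final theorem mention the Ising model.
No definitions are introduced.
-/

namespace Summit.CriticalPhenomena.Ising3DConformalLimit.ThresholdDilationGlue

open Filter Topology
open scoped InnerProductSpace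
open Literature.Probability.LatticeModels
open Summit.CriticalPhenomena.Ising3DConformalLimit.Theses.ThresholdDilation

/-! ## Elementary real analysis -/

/-- A sequence converges along a filter if its even- and odd-indexed subsequences do. [folklore] -/
theorem tendsto_of_even_odd {α : Type*} {f : ℕ → α} {l : Filter α}
    (he : Tendsto (fun m => f (2 * m)) atTop l) (ho : Tendsto (fun m => f (2 * m + 1)) atTop l) :
    Tendsto f atTop l := by
  rw [tendsto_atTop'] at he ho ⊢
  intro s hs
  obtain ⟨a, ha⟩ := he s hs
  obtain ⟨b, hb⟩ := ho s hs
  refine ⟨2 * max a b + 1, fun n hn => ?_⟩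
  obtain ⟨k, hk | hk⟩ := Nat.even_or_odd' n
  · have hk' : max a b ≤ k := by omega
    rw [hk]
    exact ha k (le_trans (le_max_left a b) hk')
  · have hk' : max a b ≤ k := by omega
    rw [hk]
    exact hb k (le_trans (le_max_right a b) hk')

/-- **Dyadic ratios from the even subsequence plus ratio regularity.** If `G > 0`,
`G(k+1)/G(k) → 1` and `G(4m)·B/G(2m) → 1`, then `G(2n)·B/G(n) → 1` along all `n`: for odd
`n = 2m+1`, `G(4m+2)·B/G(2m+1) = [G(4m)·B/G(2m)]·r(4m)·r(4m+1)/r(2m)` with `r(k) = G(k+1)/G(k) → 1`.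
[folklore] -/
theorem tendsto_dyadic_of_even {G : ℕ → ℝ} (hpos : ∀ n, 0 < G n)
    (hratio : Tendsto (fun k => G (k + 1) / G k) atTop (𝓝 1)) {B : ℝ}
    (heven : Tendsto (fun m => G (2 * (2 * m)) * B / G (2 * m)) atTop (𝓝 1)) :
    Tendsto (fun n => G (2 * n) * B / G n) atTop (𝓝 1) := by
  have h4 : Tendsto (fun m : ℕ => 4 * m) atTop atTop :=
    tendsto_atTop_mono (fun m => by dsimp only [id]; omega) tendsto_id
  have h41 : Tendsto (fun m : ℕ => 4 * m + 1) atTop atTop :=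
    tendsto_atTop_mono (fun m => by dsimp only [id]; omega) tendsto_id
  have h2 : Tendsto (fun m : ℕ => 2 * m) atTop atTop :=
    tendsto_atTop_mono (fun m => by dsimp only [id]; omega) tendsto_id
  have e1 : Tendsto (fun m => G (4 * m + 1) / G (4 * m)) atTop (𝓝 1) := hratio.comp h4
  have e2 : Tendsto (fun m => G (4 * m + 1 + 1) / G (4 * m + 1)) atTop (𝓝 1) := hratio.comp h41
  have e3 : Tendsto (fun m => G (2 * m + 1) / G (2 * m)) atTop (𝓝 1) := hratio.comp h2
  have hodd : Tendsto (fun m => G (2 * (2 * m + 1)) * B / G (2 * m + 1)) atTop (𝓝 1) := by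
    have key := ((heven.mul e1).mul e2).div e3 one_ne_zero
    simp only [mul_one, div_one] at key
    refine key.congr fun m => ?_
    have p1 := hpos (2 * m)
    have p2 := hpos (4 * m)
    have p3 := hpos (4 * m + 1)
    have p4 := hpos (2 * m + 1)
    simp only [Pi.div_apply]
    rw [show 2 * (2 * m) = 4 * m by ring, show 2 * (2 * m + 1) = 4 * m + 1 + 1 by ring]
    field_simp
  exact tendsto_of_even_odd heven hodd

/-- **The ε-bookkeeping of the three implementer inequalities.** If `U > 0`, `W ≥ 0`, `A > 0` and
for every `ε > 0` eventually `|U m − A·W m| ≤ 2ε·U m + ε·W m`, then `A·W m / U m → 1`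
(first a bound `A W/U ≤ 2 + 2A` from `ε = A/2`, then `|1 − A W/U| ≤ 2ε + (ε/A)(2 + 2A)`).
[folklore] -/
theorem tendsto_ratio_of_eventual_bounds {U W : ℕ → ℝ} {A : ℝ} (hA : 0 < A)
    (hU : ∀ m, 0 < U m) (hW : ∀ m, 0 ≤ W m)
    (h : ∀ ε : ℝ, 0 < ε → ∀ᶠ m in atTop, |U m - A * W m| ≤ 2 * ε * U m + ε * W m) :
    Tendsto (fun m => A * W m / U m) atTop (𝓝 1) := by
  have key : ∀ ε : ℝ, 0 < ε →
      ∀ᶠ m in atTop, |1 - A * W m / U m| ≤ 2 * ε + ε / A * (A * W m / U m) := by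
    intro ε hε
    filter_upwards [h ε hε] with m hm
    have hUm := hU m
    rw [show 1 - A * W m / U m = (U m - A * W m) / U m by field_simp, abs_div, abs_of_pos hUm,
      div_le_iff₀ hUm]
    calc |U m - A * W m| ≤ 2 * ε * U m + ε * W m := hm
      _ = (2 * ε + ε / A * (A * W m / U m)) * U m := by field_simp
  have hbd : ∀ᶠ m in atTop, A * W m / U m ≤ 2 + 2 * A := by
    filter_upwards [key (A / 2) (half_pos hA)] with m hm
    have h1 := (abs_sub_le_iff.1 hm).2
    have h2 : A / 2 / A * (A * W m / U m) = (A * W m / U m) / 2 := by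
      field_simp
    rw [h2] at h1
    linarith
  refine Metric.tendsto_nhds.2 fun δ hδ => ?_
  have hε : 0 < δ * A / (2 * (4 * A + 2)) := by positivity
  filter_upwards [key _ hε, hbd] with m hm hb
  rw [Real.dist_eq, abs_sub_comm]
  have hx0 : 0 ≤ A * W m / U m := div_nonneg (mul_nonneg hA.le (hW m)) (hU m).le
  have hεA : 0 ≤ δ * A / (2 * (4 * A + 2)) / A := div_nonneg hε.le hA.le
  calc |1 - A * W m / U m|
      ≤ 2 * (δ * A / (2 * (4 * A + 2))) + δ * A / (2 * (4 * A + 2)) / A * (A * W m / U m) := hm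
    _ ≤ 2 * (δ * A / (2 * (4 * A + 2))) + δ * A / (2 * (4 * A + 2)) / A * (2 + 2 * A) := by
        gcongr
    _ = δ / 2 := by field_simp; ring
    _ < δ := half_lt_self hδ

/-! ## Hilbert-space identities for a positive operator -/

/-- For a positive (hence self-adjoint) bounded operator `T` on a complex Hilbert space,
`⟪Tⁿ x, Tⁿ x⟫ = ⟪x, T²ⁿ x⟫`. [folklore] -/
theorem inner_pow_apply_self {E : Type*} [NormedAddCommGroup E] [InnerProductSpace ℂ E]
    [CompleteSpace E] {T : E →L[ℂ] E} (hT : T.IsPositive) (x : E) (n : ℕ) :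
    ⟪(T ^ n) x, (T ^ n) x⟫_ℂ = ⟪x, (T ^ (2 * n)) x⟫_ℂ := by
  have hsa : IsSelfAdjoint (T ^ n) := hT.isSelfAdjoint.pow n
  rw [← ContinuousLinearMap.adjoint_inner_right, hsa.adjoint_eq]
  rw [show (T ^ n) ((T ^ n) x) = (T ^ (2 * n)) x by rw [two_mul, pow_add]; rfl]

/-- For a positive bounded operator `T` on a complex Hilbert space, `‖Tⁿ x‖² = ⟪x, T²ⁿ x⟫`
(as complex numbers). [folklore] -/
theorem norm_pow_apply_sq {E : Type*} [NormedAddCommGroup E] [InnerProductSpace ℂ E]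
    [CompleteSpace E] {T : E →L[ℂ] E} (hT : T.IsPositive) (x : E) (n : ℕ) :
    ((‖(T ^ n) x‖ ^ 2 : ℝ) : ℂ) = ⟪x, (T ^ (2 * n)) x⟫_ℂ := by
  rw [← inner_pow_apply_self hT x n, inner_self_eq_norm_sq_to_K]
  push_cast
  rfl

/-! ## The index conversion `⟨σ_{{0} ∆ {k e₀}}⟩⁺ = ⟨σ₀ σ_{k e₀}⟩⁺` -/

/-- The matrix-element clause of `TwoPlaneTransferRealisation` at `A = B = {0}` computes the axis
two-point function: `⟨σ_{({0}×{0}) ∆ ({0}×{k})}⟩⁺_{β_c(3),0} = ⟨σ₀ σ_{k e₀}⟩⁺_{β_c(3)}`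
(`vecCons k 0 = Pi.single 0 k`; for `k ≠ 0` the symmetric difference is the pair `{0, k e₀}` and
`σ_{{0, k e₀}} = σ₀σ_{k e₀}`; for `k = 0` both sides are the expectation of `1 = σ₀²`). [folklore] -/
theorem plusCorr_symmDiff_axis (k : ℕ) :
    plusCorr 3 (criticalBeta 3) 0
      (symmDiff (Finset.image (fun y : Fin 2 → ℤ => (Matrix.vecCons (0 : ℤ) y : Fin 3 → ℤ)) {0})
        (Finset.image (fun y : Fin 2 → ℤ => (Matrix.vecCons ((k : ℕ) : ℤ) y : Fin 3 → ℤ)) {0}))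
      = criticalTwoPoint 3 (Pi.single 0 (k : ℤ)) := by
  rw [Finset.image_singleton, Finset.image_singleton, Matrix.cons_zero_zero]
  have hv : (Matrix.vecCons ((k : ℕ) : ℤ) (0 : Fin 2 → ℤ) : Fin 3 → ℤ) = Pi.single 0 (k : ℤ) := by
    funext i
    refine Fin.cases ?_ (fun j => ?_) i
    · simp
    · simp [Fin.succ_ne_zero]
  rw [hv]
  unfold plusCorr criticalTwoPoint twoPointPlus
  congr 1
  funext s
  by_cases h0 : (Pi.single 0 (k : ℤ) : Fin 3 → ℤ) = 0
  · rw [h0, symmDiff_self]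
    simp [spinProduct, spinPair]
  · have hset : symmDiff ({0} : Finset (Fin 3 → ℤ)) {Pi.single 0 (k : ℤ)}
        = {0, Pi.single 0 (k : ℤ)} := by
      ext x
      rw [Finset.mem_symmDiff]
      simp only [Finset.mem_singleton, Finset.mem_insert]
      constructor
      · rintro (⟨h1, -⟩ | ⟨h1, -⟩)
        · exact Or.inl h1
        · exact Or.inr h1
      · rintro (h1 | h1)
        · exact Or.inl ⟨h1, fun h2 => h0 (h2.symm.trans h1)⟩
        · exact Or.inr ⟨h1, fun h2 => h0 (h1.symm.trans h2)⟩
    rw [hset]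
    simp only [spinProduct, spinPair]
    rw [Finset.prod_pair (Ne.symm h0)]

/-! ## The glue -/

/-- **`DyadicLawOfImplementer`** (route ThresholdDilation, item stmt-CriticalPhenomena-6325): the
two-plane transfer realisation (R) and the threshold dilation implementer (V) imply the dyadic
scaling law of the critical axis two-point function on `ℤ³`: with `Δ > 0` the weight of (V),
`g(2n)·4^Δ/g(n) → 1` where `g(n) = ⟨σ₀σ_{n e₀}⟩⁺_{β_c(3)}`. Proof: `‖Tᵐψ‖² = g(2m)`; the clauses
(Iso), (Int), (QP) give `|‖Tᵐψ‖ − 2^Δ‖T²ᵐψ‖| ≤ 2ε‖Tᵐψ‖ + ε‖T²ᵐψ‖` eventually, so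
`g(4m)·4^Δ/g(2m) → 1`; odd arguments by axis ratio regularity `g(k+1)/g(k) → 1`. [folklore] -/
theorem dyadicLawOfImplementer_proof : DyadicLawOfImplementer := by
  intro hR hV
  obtain ⟨T, ψ, hpos, hnorm, hcorr⟩ := hR
  obtain ⟨V, Δ, hΔ, hev⟩ := hV T ψ ⟨hpos, hnorm, hcorr⟩
  refine ⟨Δ, hΔ, ?_⟩
  -- the axis two-point function and its positivity (Simon–Lieb off the origin, `σ₀² = 1` at it)
  set G : ℕ → ℝ := fun n => criticalTwoPoint 3 (Pi.single 0 (n : ℤ)) with hG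
  have hGpos : ∀ n, 0 < G n := by
    intro n
    show 0 < criticalTwoPoint 3 (Pi.single 0 (n : ℤ))
    by_cases hx : (Pi.single 0 (n : ℤ) : Site 3) = 0
    · rw [hx, criticalTwoPoint_zero']
      exact one_pos
    · obtain ⟨c, C, hc, hb⟩ := criticalTwoPoint_bounds_holds (d := 3) le_rfl
      exact lt_of_lt_of_le (mul_pos hc (Real.rpow_pos_of_pos (norm_pos_iff.2 hx) _)) (hb _ hx).1
  -- matrix elements and norms of the low-energy vectors `Tⁿ ψ`
  have hinner : ∀ k : ℕ, ⟪ψ {0}, (T ^ k) (ψ {0})⟫_ℂ = ((G k : ℝ) : ℂ) := by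
    intro k
    rw [hcorr {0} {0} k, plusCorr_symmDiff_axis]
  have hnormsq : ∀ n : ℕ, ‖(T ^ n) (ψ {0})‖ ^ 2 = G (2 * n) := by
    intro n
    have h := norm_pow_apply_sq hpos (ψ {0}) n
    rw [hinner] at h
    exact_mod_cast h
  have hUpos : ∀ m : ℕ, 0 < ‖(T ^ m) (ψ {0})‖ := by
    intro m
    have h2 : 0 < ‖(T ^ m) (ψ {0})‖ ^ 2 := by
      rw [hnormsq m]
      exact hGpos _
    rcases (norm_nonneg ((T ^ m) (ψ {0}))).lt_or_eq with hlt | heq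
    · exact hlt
    · rw [← heq] at h2
      norm_num at h2
  -- the weight `A = 2^Δ`
  have hApos : 0 < (2 : ℝ) ^ Δ := Real.rpow_pos_of_pos two_pos Δ
  -- the three inequalities combine to `|‖u‖ - A‖w‖| ≤ 2ε‖u‖ + ε‖w‖`
  have hineq : ∀ ε : ℝ, 0 < ε → ∀ᶠ m in atTop,
      |‖(T ^ m) (ψ {0})‖ - (2 : ℝ) ^ Δ * ‖(T ^ (2 * m)) (ψ {0})‖|
        ≤ 2 * ε * ‖(T ^ m) (ψ {0})‖ + ε * ‖(T ^ (2 * m)) (ψ {0})‖ := by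
    intro ε hε
    filter_upwards [hev ε hε] with m hm
    obtain ⟨hiso, hint, hqp⟩ := hm
    have hlin : (T ^ (2 * m)) (V (ψ {0}) - (((2 : ℝ) ^ Δ : ℝ) : ℂ) • ψ {0})
        = (T ^ (2 * m)) (V (ψ {0})) - (((2 : ℝ) ^ Δ : ℝ) : ℂ) • (T ^ (2 * m)) (ψ {0}) := by
      rw [map_sub, map_smul]
    rw [hlin] at hqp
    have hsmul : ‖(((2 : ℝ) ^ Δ : ℝ) : ℂ) • (T ^ (2 * m)) (ψ {0})‖
        = (2 : ℝ) ^ Δ * ‖(T ^ (2 * m)) (ψ {0})‖ := by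
      rw [norm_smul, Complex.norm_real, Real.norm_of_nonneg hApos.le]
    have htri : |‖V ((T ^ m) (ψ {0}))‖ - (2 : ℝ) ^ Δ * ‖(T ^ (2 * m)) (ψ {0})‖|
        ≤ ε * ‖(T ^ m) (ψ {0})‖ + ε * ‖(T ^ (2 * m)) (ψ {0})‖ := by
      rw [← hsmul]
      calc |‖V ((T ^ m) (ψ {0}))‖ - ‖(((2 : ℝ) ^ Δ : ℝ) : ℂ) • (T ^ (2 * m)) (ψ {0})‖|
          ≤ ‖V ((T ^ m) (ψ {0})) - (((2 : ℝ) ^ Δ : ℝ) : ℂ) • (T ^ (2 * m)) (ψ {0})‖ :=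
            abs_norm_sub_norm_le _ _
        _ ≤ ‖V ((T ^ m) (ψ {0})) - (T ^ (2 * m)) (V (ψ {0}))‖
              + ‖(T ^ (2 * m)) (V (ψ {0})) - (((2 : ℝ) ^ Δ : ℝ) : ℂ) • (T ^ (2 * m)) (ψ {0})‖ :=
            norm_sub_le_norm_sub_add_norm_sub _ _ _
        _ ≤ ε * ‖(T ^ m) (ψ {0})‖ + ε * ‖(T ^ (2 * m)) (ψ {0})‖ := add_le_add hint hqp
    have h1 := abs_sub_le_iff.1 hiso
    have h2 := abs_sub_le_iff.1 htri
    rw [abs_sub_le_iff]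
    constructor <;> linarith [h1.1, h1.2, h2.1, h2.2]
  have hlim := tendsto_ratio_of_eventual_bounds (U := fun m => ‖(T ^ m) (ψ {0})‖)
    (W := fun m => ‖(T ^ (2 * m)) (ψ {0})‖) hApos hUpos (fun m => norm_nonneg _) hineq
  -- even arguments: `g(4m)·4^Δ/g(2m) = (A‖w‖/‖u‖)² → 1`
  have heven : Tendsto (fun m => G (2 * (2 * m)) * (4 : ℝ) ^ Δ / G (2 * m)) atTop (𝓝 1) := by
    have h2 := hlim.pow 2
    rw [one_pow] at h2
    refine h2.congr fun m => ?_
    have hU2 : ‖(T ^ m) (ψ {0})‖ ^ 2 = G (2 * m) := hnormsq m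
    have hW2 : ‖(T ^ (2 * m)) (ψ {0})‖ ^ 2 = G (2 * (2 * m)) := hnormsq (2 * m)
    have hA2 : ((2 : ℝ) ^ Δ) ^ 2 = (4 : ℝ) ^ Δ := by
      rw [← Real.rpow_natCast, ← Real.rpow_mul (by norm_num : (0 : ℝ) ≤ 2), mul_comm,
        Real.rpow_mul (by norm_num : (0 : ℝ) ≤ 2)]
      norm_num
    rw [div_pow, mul_pow, hU2, hW2, hA2]
    ring
  -- odd arguments: axis ratio regularity
  have hratio : Tendsto (fun k => G (k + 1) / G k) atTop (𝓝 1) :=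
    criticalTwoPoint_axis_ratio_tendsto_one' (0 : Fin 3)
  exact tendsto_dyadic_of_even hGpos hratio heven

end Summit.CriticalPhenomena.Ising3DConformalLimit.ThresholdDilationGlue
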